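import Summits.NavierStokesRegularity.FunctionalMining.StretchingConfinementCalculus
import Literature.Analysis.FluidPDE.MikadoRescaled
import Literature.Analysis.FluidPDE.AlexakisDoeringProofs
import Literature.Analysis.FluidPDE.EulerReynoldsMollification
import Literature.Analysis.FunctionSpaces.TorusTestFunction
import HarnessLib

/-!
# K1-Q1, the wrap blueprint: node N2 `ConfinementLemma` — part 2: error bounds for the confined curl

Cell `pub-nsfunc` (host summit NavierStokesRegularity, topic `FunctionalMining`), prove seat gen 5, on the bank seat's
`WRAP-KERNEL-BLUEPRINT.md` §5 (node N2 typed by the dictionary seat in `StretchingWrapIdentity.lean`).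
**Search for candidate a priori estimates; no regularity claim.** Static facts about smooth fields on `T³`;
nothing is asserted about Navier–Stokes.

This part: uniform bounds for finitely many continuous functions on `T³`; the remainder bound
`|∂_j(curl(E•A_m))_i − E·∂_jF_i(m•x)| ≤ (2‖∇²E‖‖A‖ + 4‖∇E‖‖∇A‖)/m`; smoothness of the filler densities
`prodBC(∇F)`, `|ω_F|²`, `(ω_F)ᵢ²`; the two-scale lemma with rate `|∫b·G(m•x) − (∫b)(∫G)| ≤ C/m²` (from the
literature's Green-pairing bound `Mikado.abs_integral_mul_comp_nsmul_le`); and the pointwise / integrated errors of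
the statistics of `u_m = curl(E•A_m)` against `∫E³·prodBC(∇F)(m•x)`, `∫E²|Ω_F|²(m•x)`, `∫E²(Ω_F)ᵢ²(m•x)`,
plus the sup bound `|ω(u_m)|² ≤ (1 + 4ρ_m)²`.
-/

noncomputable section

open MeasureTheory Set Filter Topology Function
open scoped InnerProductSpace ContDiff

namespace Summit.NavierStokesRegularity.FunctionalMining

open Literature.Analysis Literature.Analysis.FunctionSpaces Literature.Analysis.FunctionSpaces.Torus
open Literature.Analysis.FluidPDE Literature.Analysis.FluidPDE.Torus

namespace Confinement

open CellularStretching WrapStretching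

/-- `|x y| ≤ s t` from `|x| ≤ s`, `|y| ≤ t`. [folklore] -/
private theorem abs_mul_le_mul' {x y s t : ℝ} (hx : |x| ≤ s) (hy : |y| ≤ t) : |x * y| ≤ s * t := by
  rw [abs_mul]; exact mul_le_mul hx hy (abs_nonneg _) ((abs_nonneg _).trans hx)

/-! ## 5. Sup-norm constants and the remainder bound -/

/-- A uniform bound for finitely many continuous functions on `T³`. [folklore] -/
theorem exists_forall₂_abs_le {f : Fin 3 → UnitAddTorus (Fin 3) → ℝ} (hf : ∀ a, Continuous (f a)) :
    ∃ C, 0 ≤ C ∧ ∀ a x, |f a x| ≤ C := by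
  have h : ∀ a, ∃ C, 0 ≤ C ∧ ∀ x, |f a x| ≤ C := fun a => by
    obtain ⟨C, hC⟩ := isCompact_univ.exists_bound_of_continuousOn (hf a).continuousOn
    exact ⟨max C 0, le_max_right _ _, fun x => (Real.norm_eq_abs _ ▸ hC x (mem_univ x)).trans (le_max_left _ _)⟩
  choose C hC0 hC using h
  refine ⟨∑ a, C a, Finset.sum_nonneg fun a _ => hC0 a, fun a x => (hC a x).trans ?_⟩
  exact Finset.single_le_sum (fun b _ => hC0 b) (Finset.mem_univ a)

/-- A uniform bound for a doubly indexed family of continuous functions on `T³`. [folklore] -/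
theorem exists_forall₃_abs_le {f : Fin 3 → Fin 3 → UnitAddTorus (Fin 3) → ℝ} (hf : ∀ a b, Continuous (f a b)) :
    ∃ C, 0 ≤ C ∧ ∀ a b x, |f a b x| ≤ C := by
  have h : ∀ a, ∃ C, 0 ≤ C ∧ ∀ b x, |f a b x| ≤ C := fun a => exists_forall₂_abs_le (hf a)
  choose C hC0 hC using h
  refine ⟨∑ a, C a, Finset.sum_nonneg fun a _ => hC0 a, fun a b x => (hC a b x).trans ?_⟩
  exact Finset.single_le_sum (fun b _ => hC0 b) (Finset.mem_univ a)

section Remainder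

variable {E : UnitAddTorus (Fin 3) → ℝ} {A : UnitAddTorus (Fin 3) → EuclideanSpace ℝ (Fin 3)}
variable {L₁ L₂ a₀ a₁ : ℝ}

/-- **The remainder bound**: `|∂_j(curl(E•A_m))_i(x) − E(x)·∂_jF_i(m•x)| ≤ (2L₂a₀ + 4L₁a₁)/m` for `m ≥ 1`, where
`L₁, L₂` bound `∇E, ∇²E` and `a₀, a₁` bound `A, ∇A` entrywise. [ours] -/
theorem abs_gradAt_curl_confine_sub_le (hE : IsSmooth E) (hA : IsSmooth A)
    (hE1 : ∀ a x, |Torus.partialDeriv a E x| ≤ L₁)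
    (hE2 : ∀ j a x, |Torus.partialDeriv j (Torus.partialDeriv a E) x| ≤ L₂)
    (hA0 : ∀ x b, |A x b| ≤ a₀) (hA1 : ∀ j x b, |Torus.partialDeriv j A x b| ≤ a₁)
    {m : ℕ} (hm : 1 ≤ m) (x : UnitAddTorus (Fin 3)) (i j : Fin 3) :
    |gradAt (curlField (confine E (rescale A m))) x i j - E x * gradAt (curlField A) (m • x) i j| ≤
      (2 * L₂ * a₀ + 4 * L₁ * a₁) / m := by
  have hm0 : m ≠ 0 := by omega
  have hmr : (1 : ℝ) ≤ m := by exact_mod_cast hm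
  have hmpos : (0 : ℝ) < m := by linarith
  have hL₁ : 0 ≤ L₁ := (abs_nonneg _).trans (hE1 0 x)
  have hL₂ : 0 ≤ L₂ := (abs_nonneg _).trans (hE2 0 0 x)
  have ha₀ : 0 ≤ a₀ := (abs_nonneg _).trans (hA0 x 0)
  have ha₁ : 0 ≤ a₁ := (abs_nonneg _).trans (hA1 0 x 0)
  -- sizes of the rescaled pieces
  have hR0 : ∀ b, |rescale A m x b| ≤ a₀ / m := fun b => by
    rw [rescale, PiLp.smul_apply, smul_eq_mul, abs_mul, abs_inv, abs_pow, Nat.abs_cast]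
    calc ((m : ℝ) ^ 2)⁻¹ * |A (m • x) b| ≤ ((m : ℝ) ^ 2)⁻¹ * a₀ :=
          mul_le_mul_of_nonneg_left (hA0 _ _) (by positivity)
      _ ≤ (m : ℝ)⁻¹ * a₀ := by
          refine mul_le_mul_of_nonneg_right ?_ ha₀
          exact inv_anti₀ hmpos (by nlinarith)
      _ = a₀ / m := by rw [div_eq_inv_mul]
  have hR1 : ∀ k b, |Torus.partialDeriv k (rescale A m) x b| ≤ a₁ / m := fun k b => by
    rw [partialDeriv_rescale m hA, PiLp.smul_apply, smul_eq_mul, abs_mul, abs_inv, Nat.abs_cast, div_eq_inv_mul]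
    exact mul_le_mul_of_nonneg_left (hA1 _ _ _) (by positivity)
  have hRc : ∀ k, |curlField (rescale A m) x k| ≤ 2 * (a₁ / m) := fun k => by
    rw [curlField_apply]
    exact (abs_sub _ _).trans (by linarith [hR1 (k + 1) (k + 2), hR1 (k + 2) (k + 1)])
  rw [gradAt_curl_confine hE hA hm0]
  have e : E x * gradAt (curlField A) (m • x) i j +
      (Torus.partialDeriv j (Torus.partialDeriv (i + 1) E) x * rescale A m x (i + 2) -
          Torus.partialDeriv j (Torus.partialDeriv (i + 2) E) x * rescale A m x (i + 1) +
        (Torus.partialDeriv (i + 1) E x * Torus.partialDeriv j (rescale A m) x (i + 2) -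
          Torus.partialDeriv (i + 2) E x * Torus.partialDeriv j (rescale A m) x (i + 1)) +
        Torus.partialDeriv j E x * curlField (rescale A m) x i) - E x * gradAt (curlField A) (m • x) i j =
      Torus.partialDeriv j (Torus.partialDeriv (i + 1) E) x * rescale A m x (i + 2) -
          Torus.partialDeriv j (Torus.partialDeriv (i + 2) E) x * rescale A m x (i + 1) +
        (Torus.partialDeriv (i + 1) E x * Torus.partialDeriv j (rescale A m) x (i + 2) -
          Torus.partialDeriv (i + 2) E x * Torus.partialDeriv j (rescale A m) x (i + 1)) +
        Torus.partialDeriv j E x * curlField (rescale A m) x i := by ring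
  rw [e]
  have t1 := abs_mul_le_mul' (hE2 j (i + 1) x) (hR0 (i + 2))
  have t2 := abs_mul_le_mul' (hE2 j (i + 2) x) (hR0 (i + 1))
  have t3 := abs_mul_le_mul' (hE1 (i + 1) x) (hR1 j (i + 2))
  have t4 := abs_mul_le_mul' (hE1 (i + 2) x) (hR1 j (i + 1))
  have t5 := abs_mul_le_mul' (hE1 j x) (hRc i)
  calc _ ≤ |Torus.partialDeriv j (Torus.partialDeriv (i + 1) E) x * rescale A m x (i + 2) -
          Torus.partialDeriv j (Torus.partialDeriv (i + 2) E) x * rescale A m x (i + 1)| +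
        |Torus.partialDeriv (i + 1) E x * Torus.partialDeriv j (rescale A m) x (i + 2) -
          Torus.partialDeriv (i + 2) E x * Torus.partialDeriv j (rescale A m) x (i + 1)| +
        |Torus.partialDeriv j E x * curlField (rescale A m) x i| := abs_add_three _ _ _
    _ ≤ (L₂ * (a₀ / m) + L₂ * (a₀ / m)) + (L₁ * (a₁ / m) + L₁ * (a₁ / m)) + L₁ * (2 * (a₁ / m)) := by
        gcongr
        · exact (abs_sub _ _).trans (add_le_add t1 t2)
        · exact (abs_sub _ _).trans (add_le_add t3 t4)
    _ = (2 * L₂ * a₀ + 4 * L₁ * a₁) / m := by ring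

end Remainder

/-! ## 6. Smoothness of the filler densities and the two-scale lemma -/

/-- Products of smooth scalar functions are smooth (typed form). [folklore] -/
theorem isSmooth_mul' {f g : UnitAddTorus (Fin 3) → ℝ} (hf : IsSmooth f) (hg : IsSmooth g) :
    IsSmooth (fun x => f x * g x) := ContDiff.mul hf hg

/-- Differences of smooth scalar functions are smooth (typed form). [folklore] -/
theorem isSmooth_sub' {f g : UnitAddTorus (Fin 3) → ℝ} (hf : IsSmooth f) (hg : IsSmooth g) :
    IsSmooth (fun x => f x - g x) := ContDiff.sub hf hg

/-- Powers of smooth scalar functions are smooth (typed form). [folklore] -/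
theorem isSmooth_pow' {f : UnitAddTorus (Fin 3) → ℝ} (hf : IsSmooth f) (n : ℕ) : IsSmooth (fun x => f x ^ n) :=
  ContDiff.pow hf n

/-- Finite sums of smooth scalar functions are smooth (typed form). [folklore] -/
theorem isSmooth_finset_sum {ι : Type*} (s : Finset ι) {f : ι → UnitAddTorus (Fin 3) → ℝ}
    (h : ∀ i ∈ s, IsSmooth (f i)) : IsSmooth (fun x => ∑ i ∈ s, f i x) := by
  have e : Torus.lift (fun x => ∑ i ∈ s, f i x) = fun y => ∑ i ∈ s, Torus.lift (f i) y := by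
    funext y; simp only [Torus.lift, Function.comp_apply]
  unfold IsSmooth
  rw [e]
  exact ContDiff.sum fun i hi => h i hi

/-- Entries of the gradient matrix of a smooth field are smooth functions of the point. [folklore] -/
theorem isSmooth_gradAt {v : UnitAddTorus (Fin 3) → EuclideanSpace ℝ (Fin 3)} (hv : IsSmooth v) (i j : Fin 3) :
    IsSmooth fun x => gradAt v x i j :=
  (hv.partialDeriv j).apply i

/-- `vort X i = X_{i+2,i+1} − X_{i+1,i+2}`. [ours; bookkeeping] -/
theorem vort_eq (X : Fin 3 → Fin 3 → ℝ) (i : Fin 3) : vort X i = X (i + 2) (i + 1) - X (i + 1) (i + 2) := by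
  fin_cases i <;> rfl

/-- **The production density `x ↦ prodBC(∇v(x))` is smooth.** [ours; elementary] -/
theorem isSmooth_prodBC_gradAt {v : UnitAddTorus (Fin 3) → EuclideanSpace ℝ (Fin 3)} (hv : IsSmooth v) :
    IsSmooth fun x => prodBC (gradAt v x) := by
  have e : (fun x => prodBC (gradAt v x)) = fun x => ∑ a, ∑ b, ∑ c,
      (gradAt v x a b * gradAt v x b c * gradAt v x c a - gradAt v x a c * gradAt v x b c * gradAt v x b a) :=
    funext fun x => prodBC_eq_sum3 _
  rw [e]
  have hg := isSmooth_gradAt hv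
  exact isSmooth_finset_sum _ fun a _ => isSmooth_finset_sum _ fun b _ => isSmooth_finset_sum _ fun c _ =>
    isSmooth_sub' (isSmooth_mul' (isSmooth_mul' (hg a b) (hg b c)) (hg c a))
      (isSmooth_mul' (isSmooth_mul' (hg a c) (hg b c)) (hg b a))

/-- **The squared vorticity components `x ↦ vort(∇v(x))ᵢ²` are smooth.** [ours; elementary] -/
theorem isSmooth_vort_sq {v : UnitAddTorus (Fin 3) → EuclideanSpace ℝ (Fin 3)} (hv : IsSmooth v) (i : Fin 3) :
    IsSmooth fun x => vort (gradAt v x) i ^ 2 := by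
  have e : (fun x => vort (gradAt v x) i ^ 2) = fun x => (gradAt v x (i + 2) (i + 1) - gradAt v x (i + 1) (i + 2)) ^ 2 :=
    funext fun x => by rw [vort_eq]
  rw [e]
  exact isSmooth_pow' (isSmooth_sub' (isSmooth_gradAt hv _ _) (isSmooth_gradAt hv _ _)) 2

/-- **`x ↦ |ω_v(x)|² = ∑ᵢ vort(∇v(x))ᵢ²` is smooth.** [ours; elementary] -/
theorem isSmooth_sum_vort_sq {v : UnitAddTorus (Fin 3) → EuclideanSpace ℝ (Fin 3)} (hv : IsSmooth v) :
    IsSmooth fun x => ∑ i, vort (gradAt v x) i ^ 2 :=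
  isSmooth_finset_sum _ fun i _ => isSmooth_vort_sq hv i

/-- **Two-scale lemma with rate** (from the literature's Green-pairing bound
`Mikado.abs_integral_mul_comp_nsmul_le`): for smooth `b`, `G` on `T³` there is `C ≥ 0` with
`|∫ b(x)G(m•x) dx − (∫b)(∫G)| ≤ C/m²` for all `m ≥ 1`. [ours] -/
theorem two_scale {b G : UnitAddTorus (Fin 3) → ℝ} (hb : IsSmooth b) (hG : IsSmooth G) :
    ∃ C, 0 ≤ C ∧ ∀ m : ℕ, 1 ≤ m → |(∫ x, b x * G (m • x)) - (∫ x, b x) * ∫ x, G x| ≤ C / (m : ℝ) ^ 2 := by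
  obtain ⟨K, hK0, hK⟩ : ∃ K, 0 ≤ K ∧ ∀ y, |Torus.laplacian b y| ≤ K := by
    obtain ⟨C, hC⟩ := isCompact_univ.exists_bound_of_continuousOn hb.laplacian.continuous.continuousOn
    exact ⟨max C 0, le_max_right _ _, fun y => (Real.norm_eq_abs _ ▸ hC y (mem_univ y)).trans (le_max_left _ _)⟩
  set G0 : ℝ := ∫ x, G x
  have hGt : IsSmooth (fun y => G y - G0) := hG.sub (isSmooth_const _)
  have hGt0 : ∫ y, (G y - G0) = 0 := by
    rw [integral_sub hG.integrable (integrable_const _)]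
    simp [G0]
  refine ⟨K * Real.sqrt (∫ y, Torus.invLaplacian (fun y => G y - G0) y ^ 2), by positivity, fun m hm => ?_⟩
  have hm0 : 0 < m := hm
  have key := Mikado.abs_integral_mul_comp_nsmul_le (d := Fin 3) (by simp) hb hGt hGt0 (σ := m) hm0 hK
  have hi1 : Integrable (fun x => b x * G (m • x)) volume :=
    (hb.continuous.mul ((hG.continuous).comp (continuous_nsmul m))).integrable_unitAddTorus
  have hi2 : Integrable (fun x => b x * G0) volume := (hb.continuous.mul continuous_const).integrable_unitAddTorus
  have e : (∫ x, b x * G (m • x)) - (∫ x, b x) * G0 = ∫ x, b x * (G (m • x) - G0) := by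
    rw [← integral_mul_const, ← integral_sub hi1 hi2]
    exact integral_congr_ae (ae_of_all _ fun x => by ring)
  rw [e]
  calc |∫ x, b x * (G (m • x) - G0)| ≤ (((m : ℝ)) ^ 2)⁻¹ * K * Real.sqrt (∫ y, Torus.invLaplacian (fun y => G y - G0) y ^ 2) := key
    _ = K * Real.sqrt (∫ y, Torus.invLaplacian (fun y => G y - G0) y ^ 2) / (m : ℝ) ^ 2 := by ring

/-! ## 7. Statistics of the confined curl: pointwise and integrated errors -/

section Statistics

variable {E : UnitAddTorus (Fin 3) → ℝ} {A : UnitAddTorus (Fin 3) → EuclideanSpace ℝ (Fin 3)}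
variable {L₁ L₂ a₀ a₁ β : ℝ}
variable (hE : IsSmooth E) (hA : IsSmooth A) (hE01 : ∀ x, 0 ≤ E x ∧ E x ≤ 1)
  (hE1 : ∀ a x, |Torus.partialDeriv a E x| ≤ L₁)
  (hE2 : ∀ j a x, |Torus.partialDeriv j (Torus.partialDeriv a E) x| ≤ L₂)
  (hA0 : ∀ x b, |A x b| ≤ a₀) (hA1 : ∀ j x b, |Torus.partialDeriv j A x b| ≤ a₁)
  (hβ : ∀ x i j, |gradAt (curlField A) x i j| ≤ β)

/-- The error scale `ρ_m = (2L₂a₀ + 4L₁a₁)/m`. [ours; bookkeeping] -/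
def rho (L₁ L₂ a₀ a₁ : ℝ) (m : ℕ) : ℝ := (2 * L₂ * a₀ + 4 * L₁ * a₁) / m

include hE hA hE01 hE1 hE2 hA0 hA1 hβ in
/-- **Pointwise errors of the confined curl** (`m ≥ 1`, `ρ = ρ_m`): production density within
`162ρ(β+ρ)²` of `E³·prodBC(∇F(m•x))`, squared vorticity components within `8ρ(β+ρ)` of `E²·vortᵢ²`, and
`|ω|² ≤ (1+4ρ)²` when `|Ω_F|² ≤ 1`. [ours] -/
theorem pointwise_errors {m : ℕ} (hm : 1 ≤ m) (x : UnitAddTorus (Fin 3)) :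
    |prodBC (gradAt (curlField (confine E (rescale A m))) x) -
        E x ^ 3 * prodBC (gradAt (curlField A) (m • x))| ≤
      162 * rho L₁ L₂ a₀ a₁ m * (β + rho L₁ L₂ a₀ a₁ m) ^ 2 ∧
    (∀ i, |vort (gradAt (curlField (confine E (rescale A m))) x) i ^ 2 -
        E x ^ 2 * vort (gradAt (curlField A) (m • x)) i ^ 2| ≤ 8 * rho L₁ L₂ a₀ a₁ m * (β + rho L₁ L₂ a₀ a₁ m)) ∧
    ((∀ y, torusVorticitySqAt (curlField A) y ≤ 1) →
      torusVorticitySqAt (curlField (confine E (rescale A m))) x ≤ (1 + 4 * rho L₁ L₂ a₀ a₁ m) ^ 2) := by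
  have hY : ∀ i j, |gradAt (curlField (confine E (rescale A m))) x i j - E x * gradAt (curlField A) (m • x) i j| ≤
      rho L₁ L₂ a₀ a₁ m := fun i j => abs_gradAt_curl_confine_sub_le hE hA hE1 hE2 hA0 hA1 hm x i j
  have he : |E x| ≤ 1 := by rw [abs_of_nonneg (hE01 x).1]; exact (hE01 x).2
  refine ⟨abs_prodBC_sub_le he (hβ (m • x)) hY, fun i => abs_vort_sq_sub_le he (hβ (m • x)) hY i, fun hΩ => ?_⟩
  rw [torusVorticitySqAt_eq_sum_sq, vorticityComp_eq_vort]
  have h1 : ∑ i, vort (gradAt (curlField A) (m • x)) i ^ 2 ≤ 1 := by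
    have := hΩ (m • x); rwa [torusVorticitySqAt_eq_sum_sq, vorticityComp_eq_vort] at this
  exact sum_vort_sq_le (hE01 x).1 (hE01 x).2 h1 hY

/-- `|∫f − ∫g| ≤ c` from a pointwise bound `|f − g| ≤ c` (probability space, continuous `f, g`). [folklore] -/
theorem abs_integral_sub_le_of_pointwise {f g : UnitAddTorus (Fin 3) → ℝ} (hf : Continuous f) (hg : Continuous g)
    {c : ℝ} (h : ∀ x, |f x - g x| ≤ c) : |(∫ x, f x) - ∫ x, g x| ≤ c := by
  rw [← integral_sub hf.integrable_unitAddTorus hg.integrable_unitAddTorus]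
  calc |∫ x, (f x - g x)| ≤ ∫ x, |f x - g x| := abs_integral_le_integral_abs
    _ ≤ ∫ _x : UnitAddTorus (Fin 3), c := integral_mono (hf.sub hg).abs.integrable_unitAddTorus (integrable_const c) h
    _ = c := by simp

include hE hA hE01 hE1 hE2 hA0 hA1 hβ in
/-- **Integrated errors of the confined curl** (`m ≥ 1`): `σ`, `2ℰ` and `T_ii` of `u_m = curl(E•A_m)` are within
`162ρ(β+ρ)²`, `24ρ(β+ρ)`, `8ρ(β+ρ)` of `∫E³·prodBC(∇F)(m•x)`, `∫E²·|Ω_F|²(m•x)`, `∫E²·(Ω_F)ᵢ²(m•x)`. [ours] -/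
theorem integrated_errors {m : ℕ} (hm : 1 ≤ m) :
    |enstrophyProduction (curlField (confine E (rescale A m))) -
        ∫ x, E x ^ 3 * prodBC (gradAt (curlField A) (m • x))| ≤
      162 * rho L₁ L₂ a₀ a₁ m * (β + rho L₁ L₂ a₀ a₁ m) ^ 2 ∧
    |2 * torusEnstrophy (curlField (confine E (rescale A m))) -
        ∫ x, E x ^ 2 * ∑ i, vort (gradAt (curlField A) (m • x)) i ^ 2| ≤
      24 * rho L₁ L₂ a₀ a₁ m * (β + rho L₁ L₂ a₀ a₁ m) ∧
    ∀ i, |vorticityMoment (curlField (confine E (rescale A m))) i i -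
        ∫ x, E x ^ 2 * vort (gradAt (curlField A) (m • x)) i ^ 2| ≤ 8 * rho L₁ L₂ a₀ a₁ m * (β + rho L₁ L₂ a₀ a₁ m) := by
  have hB : IsSmooth (confine E (rescale A m)) := isSmooth_confine hE (isSmooth_rescale m hA)
  have hu : IsSmooth (curlField (confine E (rescale A m))) := isSmooth_curlField hB
  have hdu : IsDivFree (curlField (confine E (rescale A m))) := isDivFree_curlField hB
  have hF : IsSmooth (curlField A) := isSmooth_curlField hA
  have hP := fun x => pointwise_errors hE hA hE01 hE1 hE2 hA0 hA1 hβ hm x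
  have hEc : Continuous E := hE.continuous
  have hns : Continuous fun x : UnitAddTorus (Fin 3) => m • x := continuous_nsmul m
  refine ⟨?_, ?_, fun i => ?_⟩
  · rw [enstrophyProduction_eq_integral_prodBC hu hdu]
    exact abs_integral_sub_le_of_pointwise (continuous_prodBC_gradAt hu)
      ((hEc.pow 3).mul ((continuous_prodBC_gradAt hF).comp hns)) fun x => (hP x).1
  · rw [two_mul_torusEnstrophy_eq_integral_vort hu hdu]
    refine abs_integral_sub_le_of_pointwise (continuous_finsetSum _ fun i _ => (continuous_vort_gradAt hu i).pow 2)
      ((hEc.pow 2).mul ((continuous_finsetSum _ fun i _ => (continuous_vort_gradAt hF i).pow 2).comp hns))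
      fun x => ?_
    have h := (hP x).2.1
    calc |∑ i, vort (gradAt (curlField (confine E (rescale A m))) x) i ^ 2 -
          E x ^ 2 * ∑ i, vort (gradAt (curlField A) (m • x)) i ^ 2|
        = |∑ i, (vort (gradAt (curlField (confine E (rescale A m))) x) i ^ 2 -
            E x ^ 2 * vort (gradAt (curlField A) (m • x)) i ^ 2)| := by
          rw [Finset.mul_sum, ← Finset.sum_sub_distrib]
      _ ≤ ∑ i, |vort (gradAt (curlField (confine E (rescale A m))) x) i ^ 2 -
            E x ^ 2 * vort (gradAt (curlField A) (m • x)) i ^ 2| := Finset.abs_sum_le_sum_abs _ _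
      _ ≤ ∑ _i : Fin 3, 8 * rho L₁ L₂ a₀ a₁ m * (β + rho L₁ L₂ a₀ a₁ m) := Finset.sum_le_sum fun i _ => h i
      _ = 24 * rho L₁ L₂ a₀ a₁ m * (β + rho L₁ L₂ a₀ a₁ m) := by simp; ring
  · rw [vorticityMoment_eq]
    exact abs_integral_sub_le_of_pointwise ((continuous_vort_gradAt hu i).pow 2)
      ((hEc.pow 2).mul (((continuous_vort_gradAt hF i).pow 2).comp hns)) fun x => (hP x).2.1 i

end Statistics

end Confinement

end Summit.NavierStokesRegularity.FunctionalMining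

end
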